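import Literature.NumberTheory.Multiplicative.SmoothNumbersRankinTail
import HarnessLib

/-!
# Route `ChenParityOracleBLAP` — crux S1 = `HostParityFromBrick` (stmt-Parity-20045): the sifting tail summed over `b` and `d`

Support file for the prime half `K1 → K2 → HP1` of S1, sifting step (S).  The tail of the
truncated sifting identity for the inner variable `t ≤ u/b`, weighted by `τ(t)`, summed over the
outer variable `b ≤ B` and over the moduli `d` (each `d ∣ bt+2` counted once), is bounded by the
divisor-weighted sum over the sparse set at height `u` (`sifting_tail_le`):
`∑_d ∑_{b ≤ B} ∑_{t ≤ u/b sparse} τ(t) [d ∣ bt+2] ≤ ∑_{k ≤ u sparse} τ(k)² τ(k+2)`.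

References: H. Iwaniec, E. Kowalski, *Analytic Number Theory* (2004), §13.4 [IwaniecKowalski2004].
-/

namespace Summit.Parity.GeneralizedHardyLittlewood.Theorems

open Finset Real
open scoped ArithmeticFunction.sigma
open ArithmeticFunction (sigma)

/-- `#{d ∈ D : d ∣ m} ≤ τ(m)` for `m ≠ 0`. -/
theorem card_filter_dvd_le_sigma_zero (D : Finset ℕ) {m : ℕ} (hm : m ≠ 0) :
    #(D.filter (fun d => d ∣ m)) ≤ σ 0 m := by
  rw [ArithmeticFunction.sigma_zero_apply]
  refine Finset.card_le_card fun d hd => ?_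
  rw [Finset.mem_filter] at hd
  exact Nat.mem_divisors.2 ⟨hd.2, hm⟩

/-- `τ(m) ≤ τ(k)` for `m ∣ k`, `k ≠ 0`. -/
theorem sigma_zero_le_of_dvd {m k : ℕ} (h : m ∣ k) (hk : k ≠ 0) : σ 0 m ≤ σ 0 k := by
  rw [ArithmeticFunction.sigma_zero_apply, ArithmeticFunction.sigma_zero_apply]
  exact Finset.card_le_card (Nat.divisors_subset_of_dvd hk h)

/-- **The sifting tail, summed over `b` and `d`.**  With
`S(v) = {k ∈ [1,v] : ∃ e ∣ k, e N-smooth, Y ≤ e}`: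
`∑_{d ∈ D} ∑_{b ≤ B} ∑_{t ∈ S(u/b)} τ(t) [d ∣ bt+2] ≤ ∑_{k ∈ S(u)} τ(k)² τ(k+2)`. -/
theorem sifting_tail_le (D : Finset ℕ) (B u N : ℕ) (Y : ℝ) :
    ∑ d ∈ D, ∑ b ∈ Icc 1 B, ∑ t ∈ (Icc 1 (u / b)).filter
        (fun k => ∃ e ∈ k.divisors, e ∈ Nat.smoothNumbers N ∧ Y ≤ (e : ℝ)),
        (σ 0 t : ℝ) * (if d ∣ b * t + 2 then 1 else 0) ≤
      ∑ k ∈ (Icc 1 u).filter (fun k => ∃ e ∈ k.divisors, e ∈ Nat.smoothNumbers N ∧ Y ≤ (e : ℝ)),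
        (σ 0 k : ℝ) ^ 2 * (σ 0 (k + 2) : ℝ) := by
  classical
  set Sp : ℕ → Finset ℕ := fun v => (Icc 1 v).filter
    (fun k => ∃ e ∈ k.divisors, e ∈ Nat.smoothNumbers N ∧ Y ≤ (e : ℝ)) with hSp
  -- Step 1: sum over `d` first: `∑_d [d ∣ bt+2] ≤ τ(bt+2)`
  rw [Finset.sum_comm]
  have h1 : ∀ b ∈ Icc 1 B, ∑ d ∈ D, ∑ t ∈ Sp (u / b), (σ 0 t : ℝ) * (if d ∣ b * t + 2 then 1 else 0) ≤
      ∑ t ∈ Sp (u / b), (σ 0 t : ℝ) * (σ 0 (b * t + 2) : ℝ) := by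
    intro b _
    rw [Finset.sum_comm]
    refine Finset.sum_le_sum fun t _ => ?_
    rw [← Finset.mul_sum]
    refine mul_le_mul_of_nonneg_left ?_ (Nat.cast_nonneg _)
    rw [← Finset.sum_filter, Finset.sum_const, nsmul_eq_mul, mul_one]
    exact_mod_cast card_filter_dvd_le_sigma_zero D (by omega : b * t + 2 ≠ 0)
  refine (Finset.sum_le_sum h1).trans ?_
  -- Step 2: reindex `t ↦ k = bt` into `S(u)` with `b ∣ k`
  have h2 : ∀ b ∈ Icc 1 B, ∑ t ∈ Sp (u / b), (σ 0 t : ℝ) * (σ 0 (b * t + 2) : ℝ) ≤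
      ∑ k ∈ (Sp u).filter (fun k => b ∣ k), (σ 0 (k / b) : ℝ) * (σ 0 (k + 2) : ℝ) := by
    intro b hb
    rw [Finset.mem_Icc] at hb
    have hb0 : 0 < b := hb.1
    have hinj : Set.InjOn (fun t => b * t) (Sp (u / b) : Set ℕ) := by
      intro t _ t' _ h; exact Nat.eq_of_mul_eq_mul_left hb0 h
    have himg : ∀ t ∈ Sp (u / b), (σ 0 ((b * t) / b) : ℝ) * (σ 0 (b * t + 2) : ℝ) =
        (σ 0 t : ℝ) * (σ 0 (b * t + 2) : ℝ) := by
      intro t _; rw [Nat.mul_div_cancel_left t hb0]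
    have heq : ∑ t ∈ Sp (u / b), (σ 0 t : ℝ) * (σ 0 (b * t + 2) : ℝ) =
        ∑ k ∈ (Sp (u / b)).image (fun t => b * t), (σ 0 (k / b) : ℝ) * (σ 0 (k + 2) : ℝ) := by
      rw [Finset.sum_image hinj]; exact (Finset.sum_congr rfl himg).symm
    rw [heq]
    refine Finset.sum_le_sum_of_subset_of_nonneg ?_ fun k _ _ => by positivity
    intro k hk
    rw [Finset.mem_image] at hk
    obtain ⟨t, ht, rfl⟩ := hk
    simp only [hSp, Finset.mem_filter, Finset.mem_Icc] at ht ⊢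
    obtain ⟨⟨ht1, htu⟩, e, he, hsm, hYe⟩ := ht
    refine ⟨⟨⟨Nat.le_mul_of_pos_right b ht1 |>.trans' hb0, ?_⟩, e, ?_, hsm, hYe⟩, dvd_mul_right b t⟩
    · exact (Nat.mul_le_mul_left b htu).trans (Nat.mul_div_le u b)
    · exact Nat.mem_divisors.2 ⟨(Nat.dvd_of_mem_divisors he).trans (dvd_mul_left t b), by
        have := Nat.pos_of_mem_divisors he; positivity⟩
  refine (Finset.sum_le_sum h2).trans ?_
  -- Step 3: swap to `∑_{k ∈ S(u)} τ(k+2) ∑_{b ≤ B, b ∣ k} τ(k/b) ≤ ∑_k τ(k)² τ(k+2)`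
  have h3 : ∑ b ∈ Icc 1 B, ∑ k ∈ (Sp u).filter (fun k => b ∣ k), (σ 0 (k / b) : ℝ) * (σ 0 (k + 2) : ℝ) =
      ∑ k ∈ Sp u, ∑ b ∈ (Icc 1 B).filter (fun b => b ∣ k), (σ 0 (k / b) : ℝ) * (σ 0 (k + 2) : ℝ) := by
    have : ∀ b ∈ Icc 1 B, ∑ k ∈ (Sp u).filter (fun k => b ∣ k), (σ 0 (k / b) : ℝ) * (σ 0 (k + 2) : ℝ) =
        ∑ k ∈ Sp u, if b ∣ k then (σ 0 (k / b) : ℝ) * (σ 0 (k + 2) : ℝ) else 0 :=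
      fun b _ => Finset.sum_filter _ _
    rw [Finset.sum_congr rfl this, Finset.sum_comm]
    refine Finset.sum_congr rfl fun k _ => ?_
    rw [Finset.sum_filter]
  rw [h3]
  refine Finset.sum_le_sum fun k hk => ?_
  have hk0 : k ≠ 0 := by
    simp only [hSp, Finset.mem_filter, Finset.mem_Icc] at hk; omega
  have h4 : ∀ b ∈ (Icc 1 B).filter (fun b => b ∣ k), (σ 0 (k / b) : ℝ) * (σ 0 (k + 2) : ℝ) ≤
      (σ 0 k : ℝ) * (σ 0 (k + 2) : ℝ) := by
    intro b hb
    rw [Finset.mem_filter] at hb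
    refine mul_le_mul_of_nonneg_right ?_ (Nat.cast_nonneg _)
    exact_mod_cast sigma_zero_le_of_dvd (Nat.div_dvd_of_dvd hb.2) hk0
  refine (Finset.sum_le_sum h4).trans ?_
  rw [Finset.sum_const, nsmul_eq_mul]
  have hc : (#((Icc 1 B).filter (fun b => b ∣ k)) : ℝ) ≤ σ 0 k := by
    exact_mod_cast card_filter_dvd_le_sigma_zero (Icc 1 B) hk0
  have h0 : (0 : ℝ) ≤ (σ 0 k : ℝ) * (σ 0 (k + 2) : ℝ) := by positivity
  nlinarith

end Summit.Parity.GeneralizedHardyLittlewood.Theorems
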